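import Summits.ResolutionOfSingularities.ResolutionOfSingularities.Theorems.MarkedTransferCampaignW46ThreefoldsComponents
import Literature.AlgebraicGeometry.Resolution.NearPointsLocus
import HarnessLib

/-!
# [OURS · L1 W4.6 rung (ii)] THREEFOLD HYPERSURFACES — both reductions from the SINGULAR-LOCUS top-stratum shape
# `NablaTopSing` (the `Inv`-string is consulted only at singular points), transporting orders off the centre
# (companion of `Theorems/MarkedTransferCampaignW46Threefolds.lean` v3, `…Reduction.lean`, `…Components.lean`)

Cell res-hironaka, LADDER-RESOLUTION rung L (D-0089), slot W4.6, rung (ii); seat res-L1-s46-pv-3. Host route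
MarkedTransfer, `--supports stmt-ResolutionOfSingularities-16156` (`HypersurfaceOrderReductionDimLeThree`).

HONEST FRAMING. Pure logic over the OURS campaign definitions plus the tree: `Hironaka2017.InvStringOrder` (order of
the typed strings), `Resolution.componentsIn` / `strictTransformSet` (de Jong 4.27 count), and — new in this file —
`Resolution.NearPointsLocus`'s `IsBlowup.idealOrder_controlledTransform_eq_of_not_mem_support` (CoP 2008, Prop. 4.2:
off the centre a blow-up preserves the order of the controlled transform; kernel-proved in the tree), with Mathlib's
Jacobson / Noetherian scheme facts. NOTHING here is a statement of H. Hironaka's manuscript (2017-03-23,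
[Hironaka2017]) and nothing here asserts that any statement of it holds; the typed candidate `S16Proof.Thm16_6` occurs
only as the HYPOTHESIS of the `_of_thm16_6_sing` variants. FACT-LIST premises: none. AI review is weaker than expert
review. No `sorry`; axioms standard.

## Why this file (design note of the 00:05Z STATUS line, resolved)

The landed shape `NablaTop` asks (T2) — «strictly smaller `Inv`-string off `∇(E)`» — at EVERY closed point off
`∇(E)`, including the closed points OUTSIDE `Sing(E)`, where Eq. (34) p.24 does not define `Inv_ξ` and a reading's
value is conventional. The weaker shape `NablaTopSing` (statement module v3) asks (T2) only on `Sing(E) ∖ ∇(E)`.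
Both reductions survive the weakening because the `Inv`-string is only ever consulted at points whose image is
singular: the closed points of `∇(E′) ⊆ Sing(E′)` map into `Sing(E)` (`Step.apply_mem_sing`: over the centre since
`D ⊆ ∇(E) ⊆ Sing(E)`, off the centre by order transport), and the closed points over `∇(E) ∖ D` are singular for
`E′` (`Step.mem_sing_of_apply_mem_sing`). Hence:

* `terminatesWhole_of_decrease_sing : DecreaseAlongSteps → NablaTopSing → OffCentreLocal → TerminatesWhole`;
* `terminatesNabla_of_decrease_sing : DecreaseAlongSteps → EqualityAlongSteps → StopsMonotone → NablaTopSing →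
  OffCentreLocal → TerminatesNabla` (+ `_of_thm16_6_sing`);
* rung (ii): `terminatesWholeII_of_decrease_sing`, `terminatesNablaII_of_decrease_sing`,
  `terminatesNablaII_of_thm16_6_sing`; and `nablaTopSing_of_nablaTop` (the new shape is weaker, so these theorems
  imply the landed ones).

## References

* statement module v3; `…ThreefoldsReduction`, `…ThreefoldsPlumbing`, `…ThreefoldsComponents` (this seat);
  tree `Resolution.NearPointsLocus` [CossartPiltant2008, Prop. 4.2], `Resolution.AlterationsNormalFormBlowupParts`
  [DeJong1996, 4.27], `Hironaka2017.InvStringOrder` [BaaderNipkow1998, §2.4]; Mathlib `JacobsonSpace`.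
* H. Hironaka, ms. 2017-03-23: Th. 16.6 p.84 l.4–32; Def. 15.12 p.80 l.37 – p.81 l.4; Eq. (34) p.24 — scope only, under
  adjudication, not cited as fact. [Hironaka2017]
-/

noncomputable section

set_option linter.dupNamespace false -- mandated namespace of this single-conjunct summit

open CategoryTheory AlgebraicGeometry TopologicalSpace

namespace Summit.ResolutionOfSingularities.ResolutionOfSingularities.Theorems

namespace CampaignW46

open Literature.AlgebraicGeometry.Resolution
open Literature.AlgebraicGeometry.Hironaka2017.S02Preliminaries
open Literature.AlgebraicGeometry.Hironaka2017.Datum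
open Literature.AlgebraicGeometry.Hironaka2017.S15ARSchemes
open Literature.AlgebraicGeometry.Hironaka2017.S16Proof
open Literature.AlgebraicGeometry.Hironaka2017.InvStringOrder

universe u

variable {n : ℕ} {p : ℕ} [Fact p.Prime] {K : Type u} [Field K] [CharP K p]

/-! ## Orders off the centre; singular points go down and (off the centre) up -/

section StepSing

variable {N : Notions.{u} n} {Rd : Reading p K N} {Rg Rg₁ Rg₂ : Regime p K}
variable {A A' : AmbientDatum p K} {E : IdealExponent A.Z} {R : Resume N A E}

/-- Pure logic: by the résumé's Def. 15.12 inclusion hypotheses, `∇(E) ⊆ Sing(Ě(0)) ⊆ Sing(E)`. [folklore] -/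
theorem Resume.nabla_subset_sing (R : Resume N A E) : (R.nabla : Set A.Z) ⊆ E.sing := by
  have hi : Def15_12_incl_1 R.T ((R.𝒴.step 0).Echeck.sing) ∧ Def15_12_incl_2 E ((R.𝒴.step 0).Echeck.sing) :=
    R.nabla_incl
  exact hi.1.trans hi.2

/-- OFF THE CENTRE THE ORDER IS UNCHANGED: for a step `s` and `π ξ′ ∉ D`, `ord_{ξ′} J′ = ord_{π ξ′} J` for the transform
`E′ = (J′, b)` of Def. 2.1 (tree `IsBlowup.idealOrder_controlledTransform_eq_of_not_mem_support`, CoP 2008 Prop. 4.2: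
the blow-up is a local isomorphism at `ξ′`). [folklore] -/
theorem Step.idealOrder_transform_of_not_mem (s : Step R A') {ξ' : A'.Z} (h : s.π ξ' ∉ (s.D : Set A.Z)) :
    idealOrder s.E'.J ξ' = idealOrder E.J (s.π ξ') := by
  haveI := A'.smooth
  haveI : IsLocallyNoetherian A'.Z := LocallyOfFiniteType.isLocallyNoetherian A'.hom
  have h' : s.π ξ' ∉ (Scheme.IdealSheafData.vanishingIdeal s.D).support := fun hm => h (by
    have hm' : s.π ξ' ∈ ((Scheme.IdealSheafData.vanishingIdeal s.D).support : Set A.Z) := hm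
    rwa [Scheme.IdealSheafData.coe_support_vanishingIdeal] at hm')
  exact s.blowup.idealOrder_controlledTransform_eq_of_not_mem_support E.J E.b h'

/-- SINGULAR POINTS GO DOWN along a step: `ξ′ ∈ Sing(E′) ⇒ π ξ′ ∈ Sing(E)` (over the centre because
`D ⊆ ∇(E) ⊆ Sing(E)`; off the centre by `Step.idealOrder_transform_of_not_mem`). [folklore] -/
theorem Step.apply_mem_sing (s : Step R A') {ξ' : A'.Z} (h : ξ' ∈ s.E'.sing) : s.π ξ' ∈ E.sing := by
  by_cases hD : s.π ξ' ∈ (s.D : Set A.Z)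
  · exact R.nabla_subset_sing (s.centre.subset_nabla hD)
  · have e := s.idealOrder_transform_of_not_mem hD
    change ((E.b : ℕ) : ℕ∞) ≤ idealOrder s.E'.J ξ' at h
    rw [e] at h
    exact h

/-- OFF THE CENTRE SINGULAR POINTS GO UP: `π ξ′ ∈ Sing(E) ∖ D ⇒ ξ′ ∈ Sing(E′)`. [folklore] -/
theorem Step.mem_sing_of_apply_mem_sing (s : Step R A') {ξ' : A'.Z} (h : s.π ξ' ∈ E.sing)
    (hD : s.π ξ' ∉ (s.D : Set A.Z)) : ξ' ∈ s.E'.sing := by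
  have e := s.idealOrder_transform_of_not_mem hD
  change ((E.b : ℕ) : ℕ∞) ≤ idealOrder s.E'.J ξ'
  rw [e]
  exact h

/-- Pure logic: the singular-locus form is WEAKER — `NablaTop N Rd Rg → NablaTopSing N Rd Rg`. [folklore] -/
theorem nablaTopSing_of_nablaTop (h : NablaTop N Rd Rg) : NablaTopSing N Rd Rg := by
  intro A E R hRg hRd
  obtain ⟨η, hηn, hηc, hT1, hT2⟩ := h A E R hRg hRd
  exact ⟨η, hηn, hηc, hT1, fun ξ hξc _ hξn => hT2 ξ hξc hξn⟩

/-- Pure logic: enlarging the regime strengthens `NablaTopSing`. [folklore] -/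
theorem nablaTopSing_antitone (hle : ∀ A E, Rg₁ A E → Rg₂ A E) (h : NablaTopSing N Rd Rg₂) :
    NablaTopSing N Rd Rg₁ :=
  fun A E R h₁ hRd => h A E R (hle A E h₁) hRd

end StepSing

/-! ## The whole-∇ reduction from the singular-locus shape -/

section WholeSing

variable {N : Notions.{u} n} {Rd : Reading p K N} {Rg : Regime p K}
variable {A A' : AmbientDatum p K} {E : IdealExponent A.Z} {R : Resume N A E}

/-- The one-step descent of `Step.descent_of_whole` with (T2) asked only on `Sing(E)`: the image `π η′` of a closed
point `η′ ∈ ∇(E′) ⊆ Sing(E′)` is a closed point of `Sing(E)` (`Step.apply_mem_sing`). [folklore] -/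
theorem Step.descent_of_whole_sing (hD : DecreaseAlongSteps N Rd Rg) (hL : OffCentreLocal N Rd Rg) (hRg : Rg A E)
    (hRd : Rd A E R) (s : Step R A') (hwhole : (s.D : Set A.Z) = (R.nabla : Set A.Z)) {η : A.Z}
    (hT1 : ∀ ξ : A.Z, ξ ∈ Literature.AlgebraicGeometry.Hironaka2017.S02Preliminaries.closedPoints A.Z →
      ξ ∈ (R.nabla : Set A.Z) → R.invStr ξ = R.invStr η)
    (hT2 : ∀ ξ : A.Z, ξ ∈ Literature.AlgebraicGeometry.Hironaka2017.S02Preliminaries.closedPoints A.Z →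
      ξ ∈ E.sing → ξ ∉ (R.nabla : Set A.Z) → InvString.LexLT (R.invStr ξ) (R.invStr η))
    {E' : IdealExponent A'.Z} (hE' : E' = s.E') (R' : Resume N A' E') (hRd' : Rd A' E' R') {η' : A'.Z}
    (hη'n : η' ∈ (R'.nabla : Set A'.Z))
    (hη' : η' ∈ Literature.AlgebraicGeometry.Hironaka2017.S02Preliminaries.closedPoints A'.Z) :
    InvString.LexLT (R'.invStr η') (R.invStr η) ∧ R'.m ≤ R.m := by
  subst hE'
  have hζ := s.apply_mem_closedPoints hη'
  have hζs : s.π η' ∈ E.sing := s.apply_mem_sing (R'.nabla_subset_sing hη'n)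
  by_cases hD' : s.π η' ∈ (s.D : Set A.Z)
  · have hstep := hD A E R hRg hRd A' s R' hRd'
    have hnot : η' ∉ R.mti.DPrime s.π s.D := by
      rw [s.dPrime_eq_empty_of_coe_eq hwhole]
      exact Set.notMem_empty _
    have h127 : Eq127 R.mti (s.π η') R'.mti η' := hstep.1 η' hη' hD' hnot
    have hmle : R'.mti.m ≤ R.mti.m := hstep.2 η' hη' hD' hnot
    have hin : s.π η' ∈ (R.nabla : Set A.Z) := by
      rw [← hwhole]
      exact hD'
    have e := hT1 _ hζ hin
    refine ⟨?_, hmle⟩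
    change InvString.LexLT (R'.invStr η') (R.invStr (s.π η')) at h127
    rwa [e] at h127
  · have e := hL A E R hRg hRd A' s R' hRd' η' hη' hD'
    have hnot : s.π η' ∉ (R.nabla : Set A.Z) := by
      rw [← hwhole]
      exact hD'
    have hlt := hT2 _ hζ hζs hnot
    refine ⟨e ▸ hlt, le_of_eq ?_⟩
    have hlen := congrArg List.length e
    simpa only [Resume.invStr, length_invStr] using hlen

/-- **WHOLE-∇ REDUCTION, SINGULAR-LOCUS FORM (general regime).** `DecreaseAlongSteps → NablaTopSing → OffCentreLocal →
TerminatesWhole` — as `terminatesWhole_of_decrease`, with the weaker top-stratum hypothesis that consults the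
`Inv`-string only at singular points. [folklore] -/
theorem terminatesWhole_of_decrease_sing (hD : DecreaseAlongSteps N Rd Rg) (hT : NablaTopSing N Rd Rg)
    (hL : OffCentreLocal N Rd Rg) : TerminatesWhole N Rd Rg := by
  intro r hw hRg
  choose η hηn hηc hT1 hT2 using fun k => hT (r.A k) (r.E k) (r.R k) (hRg k) (r.reads k)
  have hstep : ∀ k, InvString.LexLT ((r.R (k + 1)).invStr (η (k + 1))) ((r.R k).invStr (η k)) ∧
      (r.R (k + 1)).m ≤ (r.R k).m :=
    fun k => Step.descent_of_whole_sing hD hL (hRg k) (r.reads k) (r.step k) (hw k) (hT1 k) (hT2 k) (r.E_succ k)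
      (r.R (k + 1)) (r.reads (k + 1)) (hηn (k + 1)) (hηc (k + 1))
  have hm : ∀ k, (r.R k).m ≤ (r.R 0).m := by
    intro k
    induction k with
    | zero => exact le_rfl
    | succ k ih => exact (hstep k).2.trans ih
  exact eq127_no_infinite_descent_of_m_le (r.R 0).m (fun k => (r.A k).Z) (fun k => (r.R k).mti) η
    (fun k => hm k) (fun k => (hstep k).1)

end WholeSing

/-! ## The component-wise reduction from the singular-locus shape -/

section NablaSing

variable {N : Notions.{u} n} {Rd : Reading p K N} {Rg : Regime p K}
variable {A A' : AmbientDatum p K} {E : IdealExponent A.Z} {R : Resume N A E}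

/-- The pointwise comparison of `Step.padFin_le_of_step` with (T2) asked only on `Sing(E)`, for closed points `ξ′`
WHOSE IMAGE IS SINGULAR for `E` (which is where it is used: at points of `∇(E′)` and at points over `∇(E) ∖ D`).
[folklore] -/
theorem Step.padFin_le_of_step_sing (hD : DecreaseAlongSteps N Rd Rg) (hEq : EqualityAlongSteps N Rd Rg)
    (hM : StopsMonotone N Rd Rg) (hL : OffCentreLocal N Rd Rg) (hRg : Rg A E) (hRd : Rd A E R) (s : Step R A')
    {η : A.Z}
    (hT1 : ∀ ξ : A.Z, ξ ∈ Literature.AlgebraicGeometry.Hironaka2017.S02Preliminaries.closedPoints A.Z →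
      ξ ∈ (R.nabla : Set A.Z) → R.invStr ξ = R.invStr η)
    (hT2 : ∀ ξ : A.Z, ξ ∈ Literature.AlgebraicGeometry.Hironaka2017.S02Preliminaries.closedPoints A.Z →
      ξ ∈ E.sing → ξ ∉ (R.nabla : Set A.Z) → InvString.LexLT (R.invStr ξ) (R.invStr η))
    {M : ℕ} (hMm : R.m ≤ M)
    {E' : IdealExponent A'.Z} (hE' : E' = s.E') (R' : Resume N A' E') (hRd' : Rd A' E' R') {ξ' : A'.Z}
    (hξ' : ξ' ∈ Literature.AlgebraicGeometry.Hironaka2017.S02Preliminaries.closedPoints A'.Z)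
    (hξs : s.π ξ' ∈ E.sing) :
    padFin M (R'.invStr ξ') ≤ padFin M (R.invStr η) ∧
      (padFin M (R'.invStr ξ') = padFin M (R.invStr η) →
        ξ' ∈ strictTransformSet s.π (s.D : Set A.Z) (R.nabla : Set A.Z)) ∧
      (s.π ξ' ∈ (R.nabla : Set A.Z) → s.π ξ' ∉ (s.D : Set A.Z) →
        padFin M (R'.invStr ξ') = padFin M (R.invStr η)) := by
  subst hE'
  have hζ := s.apply_mem_closedPoints hξ'
  have hM' : R'.m ≤ M := (hM A E R hRg hRd A' s R' hRd').trans hMm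
  have hlenη : (R.invStr η).length ≤ M := by rw [Resume.length_invStr]; exact hMm
  have hlenξ' : (R'.invStr ξ').length ≤ M := by rw [Resume.length_invStr]; exact hM'
  by_cases hDζ : s.π ξ' ∈ (s.D : Set A.Z)
  · have hin : s.π ξ' ∈ (R.nabla : Set A.Z) := s.centre.subset_nabla hDζ
    have eζ : R.invStr (s.π ξ') = R.invStr η := hT1 _ hζ hin
    by_cases hDP : ξ' ∈ R.mti.DPrime s.π s.D
    · have h128 : Eq128 R.mti (s.π ξ') R'.mti ξ' := (hEq A E R hRg hRd A' s R' hRd') ξ' hξ' hDP.1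
      have hm' : R'.m ≤ R.m := hM A E R hRg hRd A' s R' hRd'
      have htake : R'.invStr ξ' = (R.invStr η).take R'.m := by
        rw [← eζ]
        change R'.mti.invStr R'.m ξ' = (R.mti.invStr R.m (s.π ξ')).take R'.m
        rw [invStr_eq_take R'.mti hm' ξ']
        exact congrArg (fun L => List.take R'.m L) h128
      have hle : padFin M (R'.invStr ξ') ≤ padFin M (R.invStr η) := by
        rw [htake]
        by_contra hlt
        rw [not_le] at hlt
        have hlen2 : ((R.invStr η).take R'.m).length ≤ M :=
          (List.length_take_le' _ _).trans hlenη
        exact not_lexLT_take (R.invStr η) R'.m ((lexLT_iff_padFin_lt hlenη hlen2).mpr hlt)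
      exact ⟨hle, fun _ => hDP.1, fun _ hnot => absurd hDζ hnot⟩
    · have h127 : Eq127 R.mti (s.π ξ') R'.mti ξ' := (hD A E R hRg hRd A' s R' hRd').1 ξ' hξ' hDζ hDP
      change InvString.LexLT (R'.invStr ξ') (R.invStr (s.π ξ')) at h127
      rw [eζ] at h127
      have hlt : padFin M (R'.invStr ξ') < padFin M (R.invStr η) := (lexLT_iff_padFin_lt hlenξ' hlenη).mp h127
      exact ⟨hlt.le, fun heq => absurd heq hlt.ne, fun _ hnot => absurd hDζ hnot⟩
  · have e := hL A E R hRg hRd A' s R' hRd' ξ' hξ' hDζ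
    by_cases hin : s.π ξ' ∈ (R.nabla : Set A.Z)
    · have eζ : R.invStr (s.π ξ') = R.invStr η := hT1 _ hζ hin
      have heq : padFin M (R'.invStr ξ') = padFin M (R.invStr η) := by rw [e, eζ]
      refine ⟨heq.le, fun _ => ?_, fun _ _ => heq⟩
      exact strictTransformSet.preimage_diff_subset s.π _ _ ⟨hin, hDζ⟩
    · have hlt' := hT2 _ hζ hξs hin
      rw [← e] at hlt'
      have hlt : padFin M (R'.invStr ξ') < padFin M (R.invStr η) := (lexLT_iff_padFin_lt hlenξ' hlenη).mp hlt'
      exact ⟨hlt.le, fun heq => absurd heq hlt.ne, fun hin' _ => absurd hin' hin⟩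

/-- `Step.nabla_eq_strictTransformSet_of_padFin_eq` from the singular-locus shapes at both ends: the pointwise lemma
is applied only at closed points of `∇(E′) ⊆ Sing(E′)` (whose images are singular, `Step.apply_mem_sing`) and at closed
points over `∇(E) ∖ D` (singular for `E′` by `Step.mem_sing_of_apply_mem_sing`). [folklore] -/
theorem Step.nabla_eq_strictTransformSet_of_padFin_eq_sing (hD : DecreaseAlongSteps N Rd Rg)
    (hEq : EqualityAlongSteps N Rd Rg) (hM : StopsMonotone N Rd Rg) (hL : OffCentreLocal N Rd Rg) (hRg : Rg A E)
    (hRd : Rd A E R) (s : Step R A') {η : A.Z}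
    (hT1 : ∀ ξ : A.Z, ξ ∈ Literature.AlgebraicGeometry.Hironaka2017.S02Preliminaries.closedPoints A.Z →
      ξ ∈ (R.nabla : Set A.Z) → R.invStr ξ = R.invStr η)
    (hT2 : ∀ ξ : A.Z, ξ ∈ Literature.AlgebraicGeometry.Hironaka2017.S02Preliminaries.closedPoints A.Z →
      ξ ∈ E.sing → ξ ∉ (R.nabla : Set A.Z) → InvString.LexLT (R.invStr ξ) (R.invStr η))
    {M : ℕ} (hMm : R.m ≤ M)
    {E' : IdealExponent A'.Z} (hE' : E' = s.E') (R' : Resume N A' E') (hRd' : Rd A' E' R') {η' : A'.Z}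
    (hT1' : ∀ ξ' : A'.Z, ξ' ∈ Literature.AlgebraicGeometry.Hironaka2017.S02Preliminaries.closedPoints A'.Z →
      ξ' ∈ (R'.nabla : Set A'.Z) → R'.invStr ξ' = R'.invStr η')
    (hT2' : ∀ ξ' : A'.Z, ξ' ∈ Literature.AlgebraicGeometry.Hironaka2017.S02Preliminaries.closedPoints A'.Z →
      ξ' ∈ E'.sing → ξ' ∉ (R'.nabla : Set A'.Z) → InvString.LexLT (R'.invStr ξ') (R'.invStr η'))
    (heq : padFin M (R'.invStr η') = padFin M (R.invStr η)) :
    (R'.nabla : Set A'.Z) = strictTransformSet s.π (s.D : Set A.Z) (R.nabla : Set A.Z) := by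
  subst hE'
  haveI := A'.smooth
  haveI : JacobsonSpace A'.Z := LocallyOfFiniteType.jacobsonSpace A'.hom
  have hM' : R'.m ≤ M := (hM A E R hRg hRd A' s R' hRd').trans hMm
  have hP := fun (ξ' : A'.Z)
      (hξ' : ξ' ∈ Literature.AlgebraicGeometry.Hironaka2017.S02Preliminaries.closedPoints A'.Z)
      (hξs : s.π ξ' ∈ E.sing) =>
    Step.padFin_le_of_step_sing hD hEq hM hL hRg hRd s hT1 hT2 hMm rfl R' hRd' hξ' hξs
  have h1 : ∀ ξ' : A'.Z, ξ' ∈ Literature.AlgebraicGeometry.Hironaka2017.S02Preliminaries.closedPoints A'.Z →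
      ξ' ∈ (R'.nabla : Set A'.Z) → ξ' ∈ strictTransformSet s.π (s.D : Set A.Z) (R.nabla : Set A.Z) := by
    intro ξ' hc hn
    refine (hP ξ' hc (s.apply_mem_sing (R'.nabla_subset_sing hn))).2.1 ?_
    rw [hT1' ξ' hc hn]
    exact heq
  have h2 : ∀ ξ' : A'.Z, ξ' ∈ Literature.AlgebraicGeometry.Hironaka2017.S02Preliminaries.closedPoints A'.Z →
      s.π ξ' ∈ (R.nabla : Set A.Z) → s.π ξ' ∉ (s.D : Set A.Z) → ξ' ∈ (R'.nabla : Set A'.Z) := by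
    intro ξ' hc hin hnD
    have hsing : s.π ξ' ∈ E.sing := R.nabla_subset_sing hin
    by_contra hout
    have hlt := hT2' ξ' hc (s.mem_sing_of_apply_mem_sing hsing hnD) hout
    have heq' := (hP ξ' hc hsing).2.2 hin hnD
    have hlenξ : (R'.invStr ξ').length ≤ M := by rw [Resume.length_invStr]; exact hM'
    have hlenη' : (R'.invStr η').length ≤ M := by rw [Resume.length_invStr]; exact hM'
    have hlt2 := (lexLT_iff_padFin_lt hlenξ hlenη').mp hlt
    rw [heq', heq] at hlt2
    exact lt_irrefl _ hlt2
  apply Set.Subset.antisymm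
  · have hcl : closure ((R'.nabla : Set A'.Z) ∩ _root_.closedPoints A'.Z) = (R'.nabla : Set A'.Z) :=
      closure_inter_closedPoints R'.nabla.isClosed
    rw [← hcl]
    exact closure_minimal (fun x hx => h1 x hx.2 hx.1) (strictTransformSet.isClosed _ _ _)
  · refine closure_minimal ?_ R'.nabla.isClosed
    intro x hx
    by_contra hxn
    have hdiff : IsLocallyClosed ((R.nabla : Set A.Z) \ (s.D : Set A.Z)) := by
      rw [Set.sdiff_eq]
      exact R.nabla.isClosed.isLocallyClosed.inter s.D.isClosed.isOpen_compl.isLocallyClosed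
    have hlc : IsLocallyClosed (s.π ⁻¹' ((R.nabla : Set A.Z) \ (s.D : Set A.Z)) ∩ (R'.nabla : Set A'.Z)ᶜ) :=
      (hdiff.preimage s.π.continuous).inter R'.nabla.isClosed.isOpen_compl.isLocallyClosed
    obtain ⟨y, ⟨hy1, hy2⟩, hyc⟩ :=
      nonempty_inter_closedPoints (Z := s.π ⁻¹' ((R.nabla : Set A.Z) \ (s.D : Set A.Z)) ∩ (R'.nabla : Set A'.Z)ᶜ)
        ⟨x, ⟨hx, hxn⟩⟩ hlc
    exact hy2 (h2 y hyc hy1.1 hy1.2)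

/-- **COMPONENT-WISE REDUCTION, SINGULAR-LOCUS FORM (general regime).** `DecreaseAlongSteps → EqualityAlongSteps →
StopsMonotone → NablaTopSing → OffCentreLocal → TerminatesNabla` — as `terminatesNabla_of_decrease`, with the weaker
top-stratum hypothesis that consults the `Inv`-string only at singular points. [folklore] -/
theorem terminatesNabla_of_decrease_sing (hD : DecreaseAlongSteps N Rd Rg) (hEq : EqualityAlongSteps N Rd Rg)
    (hM : StopsMonotone N Rd Rg) (hT : NablaTopSing N Rd Rg) (hL : OffCentreLocal N Rd Rg) :
    TerminatesNabla N Rd Rg := by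
  intro r hRg
  choose η hηn hηc hT1 hT2 using fun k => hT (r.A k) (r.E k) (r.R k) (hRg k) (r.reads k)
  have hmstep : ∀ k, (r.R (k + 1)).m ≤ (r.R k).m := fun k =>
    Step.stops_le hM (hRg k) (r.reads k) (r.step k).toStep (r.E_succ k) (r.R (k + 1)) (r.reads (k + 1))
  have hm : ∀ k, (r.R k).m ≤ (r.R 0).m := by
    intro k
    induction k with
    | zero => exact le_rfl
    | succ k ih => exact (hmstep k).trans ih
  -- the image of the next witness is singular: η_{k+1} ∈ ∇(E_{k+1}) ⊆ Sing(E_{k+1}) and singular points go down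
  have hηs : ∀ k, (r.step k).toStep.π (η (k + 1)) ∈ (r.E k).sing := by
    intro k
    have h1 : η (k + 1) ∈ (r.E (k + 1)).sing := (r.R (k + 1)).nabla_subset_sing (hηn (k + 1))
    rw [r.E_succ k] at h1
    exact (r.step k).toStep.apply_mem_sing h1
  have hstep : ∀ k,
      padFin (r.R 0).m ((r.R (k + 1)).invStr (η (k + 1))) ≤ padFin (r.R 0).m ((r.R k).invStr (η k)) ∧
        (padFin (r.R 0).m ((r.R (k + 1)).invStr (η (k + 1))) = padFin (r.R 0).m ((r.R k).invStr (η k)) →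
          (componentsIn ((r.R (k + 1)).nabla : Set (r.A (k + 1)).Z)).ncard <
            (componentsIn ((r.R k).nabla : Set (r.A k).Z)).ncard) := by
    intro k
    refine ⟨(Step.padFin_le_of_step_sing hD hEq hM hL (hRg k) (r.reads k) (r.step k).toStep (hT1 k) (hT2 k)
      (hm k) (r.E_succ k) (r.R (k + 1)) (r.reads (k + 1)) (hηc (k + 1)) (hηs k)).1, fun heq => ?_⟩
    have hN := Step.nabla_eq_strictTransformSet_of_padFin_eq_sing hD hEq hM hL (hRg k) (r.reads k)
      (r.step k).toStep (hT1 k) (hT2 k) (hm k) (r.E_succ k) (r.R (k + 1)) (r.reads (k + 1)) (hT1 (k + 1))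
      (hT2 (k + 1)) heq
    exact Step.ncard_componentsIn_lt (r.step k).toStep (r.step k).component (r.R (k + 1)) hN
  exact no_stalling_descent (fun k => padFin (r.R 0).m ((r.R k).invStr (η k)))
    (fun k => (componentsIn ((r.R k).nabla : Set (r.A k).Z)).ncard) (fun k => (hstep k).1) fun k => (hstep k).2

/-- The singular-locus component-wise reduction with the one-step shapes from the typed candidate `Thm16_6` (a
HYPOTHESIS, via the anchors). [folklore] -/
theorem terminatesNabla_of_thm16_6_sing [PerfectField K]
    {pPosiEmptyAt : ∀ {W : Scheme.{u}}, IdealExponent W → W → Prop}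
    (h : Thm16_6 (p := p) (K := K) n (primeR N Rd) pPosiEmptyAt) (hM : StopsMonotone N Rd Rg)
    (hT : NablaTopSing N Rd Rg) (hL : OffCentreLocal N Rd Rg) : TerminatesNabla N Rd Rg :=
  terminatesNabla_of_decrease_sing (decreaseAlongSteps_of_thm16_6 N Rd h Rg)
    (equalityAlongSteps_of_thm16_6 N Rd h Rg) hM hT hL

end NablaSing

/-! ## Rung (ii), singular-locus forms -/

section RungII

variable (N : Notions.{u} n) (Rd : Reading p K N)

/-- RUNG (ii), whole-∇ form, from the singular-locus top-stratum shape: `DecreaseII → NablaTopSingII → OffCentreLocalII →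
TerminatesWholeII`. [folklore] -/
theorem terminatesWholeII_of_decrease_sing (hD : DecreaseII N Rd) (hT : NablaTopSingII N Rd)
    (hL : OffCentreLocalII N Rd) : TerminatesWholeII N Rd :=
  terminatesWhole_of_decrease_sing hD hT hL

/-- RUNG (ii), ∇-centred form (the registered shape), from the singular-locus top-stratum shape: `DecreaseII →
EqualityII → StopsMonotoneII → NablaTopSingII → OffCentreLocalII → TerminatesNablaII`. [folklore] -/
theorem terminatesNablaII_of_decrease_sing (hD : DecreaseII N Rd) (hEq : EqualityII N Rd) (hM : StopsMonotoneII N Rd)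
    (hT : NablaTopSingII N Rd) (hL : OffCentreLocalII N Rd) : TerminatesNablaII N Rd :=
  terminatesNabla_of_decrease_sing hD hEq hM hT hL

/-- RUNG (ii), ∇-centred form, singular-locus shape, with Eq. (127)/(128) supplied by the typed candidate `Thm16_6` AS A
HYPOTHESIS: `Thm16_6 → StopsMonotoneII → NablaTopSingII → OffCentreLocalII → TerminatesNablaII`. [folklore] -/
theorem terminatesNablaII_of_thm16_6_sing [PerfectField K]
    {pPosiEmptyAt : ∀ {W : Scheme.{u}}, IdealExponent W → W → Prop}
    (h : Thm16_6 (p := p) (K := K) n (primeR N Rd) pPosiEmptyAt) (hM : StopsMonotoneII N Rd)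
    (hT : NablaTopSingII N Rd) (hL : OffCentreLocalII N Rd) : TerminatesNablaII N Rd :=
  terminatesNabla_of_thm16_6_sing h hM hT hL

end RungII

end CampaignW46

end Summit.ResolutionOfSingularities.ResolutionOfSingularities.Theorems

end
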